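/-
Copyright (c) 2026. All rights reserved.
Released under Apache 2.0 license as described in the file LICENSE.
Authors: abc-iut cell, statement-typer seat abc-iut-L4-t3 (wave 1).
-/
import Mathlib.LinearAlgebra.Span.Defs
import Mathlib.Analysis.SpecialFunctions.Trigonometric.Basic
import Literature.AnabelianGeometry.AbsoluteAnabelian.MonoAnalyticLogShells
import HarnessLib

/-!
# [AbsTopIII] Definition 5.9 (i): the global realified line `R_⊚V ⊆ ∏_v R_v`

S. Mochizuki, *Topics in absolute anabelian geometry III: global reconstruction algorithms*,
J. Math. Sci. Univ. Tokyo 22 (2015) 939–1156 [MochizukiAbsTopIII2015]; locators `p.N` = pages of the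
author's manuscript (`paper:url-5493eb38cbb7`; journal pagination not held), read on the page: Def 5.9 (i)
p. 143; Rmk 5.9.1 pp. 144–145, Rmk 5.9.2 p. 145 (records).

Def 5.9 (i): pulling back the algorithms `R_non(−)`, `R_arc(−)` of Prop 5.8 (iii), (vi) along the
mono-analyticization functors gives, for each `v ∈ V` of a global / panalocal / mono-analytic Galois-theater, an
"[orbi-]topological group [isomorphic to `ℝ`] `R_v` equipped with a distinguished Frobenius element `F_v ∈ R_v`", and
"a(n) [orbi-]topological group `R_⊚V ⊆ ∏_v R_v` obtained as the graph of the correspondences between the `R_v`'s that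
relate the `F_v/(f_v·log(p_v))` for nonarchimedean `v` to the `F_v/2π` for archimedean `v`", with distinguished element
`F_⊚V ∈ R_⊚V` ("corresponding to `1 ∈ ℝ`") and natural isomorphisms `R_⊚V ≅ R_v` mapping `F_⊚V ↦ F_v/(f_v·log(p_v))`
resp. `F_⊚V ↦ F_v/2π` ("division of elements of the abstract topological group `R_v` by a positive real number is
well-defined").

REAL definitions over `RLine` (`MonoAnalyticLogShells.lean`): given a family of lines `R_v` with Frobenius elements
and positive weights `c_v` (`= f_v·log p_v` or `2π`; `RealifiedFamily`), `globalLine` is the `ℝ`-span of the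
vector `(F_v / c_v)_v` in `∏_v R_v`, with `F_⊚V` that vector; `globalLine_proj_frob` PROVES that the projection to
`R_v` maps `F_⊚V ↦ c_v⁻¹ • F_v`. Rmk 5.9.1 (the categories `An⊚[Th•_T, μ]`, `An⊚[Th⊚_T, |⊡|, μ]` obtained by adjoining
the log-volume data; all arrows equivalences except the panalocal forgetful one) and Rmk 5.9.2 ("the significance
of measuring log-volumes in units that belong to `R_non(−)`, `R_arc(−)` lies in the fact that such measurements may
be compared on both sides of the log-wall, as well as … with mono-analyticization") are RECORD NODES cited here.
Refereed pre-IUT material; nothing here bears on [IUTchIII] Cor. 3.12; typed ≠ discharged.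
-/

set_option autoImplicit false

noncomputable section

universe u

namespace Literature.AnabelianGeometry.AbsoluteAnabelian

/-- the family `{R_v, F_v}_{v ∈ V}` of realified lines of a Galois-theater together with the normalising weights
`c_v = f_v·log(p_v)` (nonarchimedean) / `c_v = 2π` (archimedean). [cite: MochizukiAbsTopIII2015, Def 5.9 (i) p. 143] -/
structure RealifiedFamily (V : Type u) : Type (u + 1) where
  /-- `R_v` with its Frobenius element `F_v` -/
  R : V → RLine.{u}
  /-- `c_v` -/
  weight : V → ℝ
  /-- `c_v > 0` -/
  weight_pos : ∀ v, 0 < weight v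

namespace RealifiedFamily

variable {V : Type u} (Φ : RealifiedFamily V)

/-- the weights of the model situation: `f_v·log p_v` at a nonarchimedean `v` of type `t_v`, `2π` at archimedean `v`.
[cite: MochizukiAbsTopIII2015, Def 5.9 (i) p. 143] -/
def modelWeight (isArc : V → Bool) (t : V → MLFType) (v : V) : ℝ :=
  if isArc v then 2 * Real.pi else (t v).frobeniusWeight

/-- the model weights are positive. [cite: MochizukiAbsTopIII2015, Def 5.9 (i) p. 143] -/
theorem modelWeight_pos (isArc : V → Bool) (t : V → MLFType) (v : V) : 0 < modelWeight isArc t v := by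
  unfold modelWeight; split_ifs
  · positivity
  · exact (t v).frobeniusWeight_pos

/-- the vector `(F_v / c_v)_v ∈ ∏_v R_v` ("the correspondences … that relate the `F_v/(f_v·log(p_v))` … to the
`F_v/2π`"). [cite: MochizukiAbsTopIII2015, Def 5.9 (i) p. 143] -/
def frobVector : ∀ v, (Φ.R v).carrier := fun v => (Φ.weight v)⁻¹ • (Φ.R v).frob

/-- the vector `(F_v / c_v)_v` is nonzero as soon as `V` is nonempty. [cite: MochizukiAbsTopIII2015, Def 5.9 (i) p. 143] -/
theorem frobVector_ne_zero [Nonempty V] : Φ.frobVector ≠ 0 := by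
  obtain ⟨v⟩ := ‹Nonempty V›
  intro h
  have hv := congrFun h v
  simp only [frobVector, Pi.zero_apply, smul_eq_zero, inv_eq_zero] at hv
  rcases hv with hv | hv
  · exact (Φ.weight_pos v).ne' hv
  · exact (Φ.R v).frob_ne_zero hv

/-- **Def 5.9 (i)**: `R_⊚V ⊆ ∏_v R_v`, "the graph of the correspondences between the `R_v`'s", i.e. the real line
spanned by `(F_v / c_v)_v`, with Frobenius element `F_⊚V` = that vector ("corresponding to `1 ∈ ℝ`").
[cite: MochizukiAbsTopIII2015, Def 5.9 (i) p. 143] -/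
def globalLine [Nonempty V] : RLine.{u} where
  carrier := ↥(Submodule.span ℝ {Φ.frobVector})
  frob := ⟨Φ.frobVector, Submodule.mem_span_singleton_self _⟩
  frob_ne_zero h := Φ.frobVector_ne_zero (congrArg Subtype.val h)
  exists_eq_smul x := by
    obtain ⟨r, hr⟩ := Submodule.mem_span_singleton.mp x.2
    exact ⟨r, Subtype.ext hr.symm⟩

/-- the natural map `R_⊚V → R_v` (projection to the `v`-th factor). [cite: MochizukiAbsTopIII2015, Def 5.9 (i) p. 143] -/
def proj [Nonempty V] (v : V) : (Φ.globalLine).carrier →ₗ[ℝ] (Φ.R v).carrier :=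
  (LinearMap.proj v).comp (Submodule.subtype _)

/-- **Def 5.9 (i)**: `R_⊚V ≅ R_v` maps `F_⊚V ↦ F_v / c_v` (`= F_v/(f_v·log(p_v))` resp. `F_v/2π`).
[cite: MochizukiAbsTopIII2015, Def 5.9 (i) p. 143] -/
theorem proj_frob [Nonempty V] (v : V) : Φ.proj v Φ.globalLine.frob = (Φ.weight v)⁻¹ • (Φ.R v).frob := rfl

/-- the natural map `R_⊚V → R_v` is injective (so `R_⊚V ≅ R_v`, both being lines).
[cite: MochizukiAbsTopIII2015, Def 5.9 (i) p. 143] -/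
theorem proj_injective [Nonempty V] (v : V) : Function.Injective (Φ.proj v) := by
  intro x y hxy
  obtain ⟨r, hr⟩ := Φ.globalLine.exists_eq_smul x
  obtain ⟨s, hs⟩ := Φ.globalLine.exists_eq_smul y
  rw [hr, hs] at hxy ⊢
  rw [map_smul, map_smul, proj_frob] at hxy
  have hne : (Φ.weight v)⁻¹ • (Φ.R v).frob ≠ 0 :=
    smul_ne_zero (inv_ne_zero (Φ.weight_pos v).ne') (Φ.R v).frob_ne_zero
  rw [(smul_left_injective ℝ hne hxy : r = s)]

/-- the superscript `(−)^⊚` of Def 5.9 (iii): reading `x ∈ R_v` as a real number via `R_v ≅ R_⊚V ≅ ℝ`,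
`F_⊚V ↦ 1`, i.e. `x = coord(x)·F_v ↦ coord(x)·c_v`. [cite: MochizukiAbsTopIII2015, Def 5.9 (iii) p. 144] -/
def toGlobalReal (v : V) (x : (Φ.R v).carrier) : ℝ := (Φ.R v).toReal (Φ.weight v) x

/-- `F_v ↦ c_v` under `R_v → ℝ` (e.g. `F_v ↦ f_v·log p_v = -μ^log(𝔪_v)·…`, the expected normalisation).
[cite: MochizukiAbsTopIII2015, Def 5.9 (i) p. 143] -/
theorem toGlobalReal_frob (v : V) : Φ.toGlobalReal v (Φ.R v).frob = Φ.weight v := by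
  unfold toGlobalReal RLine.toReal
  have h := (Φ.R v).coord_smul_frob (Φ.R v).frob
  have h1 : ((Φ.R v).coord (Φ.R v).frob - 1) • (Φ.R v).frob = 0 := by rw [sub_smul, one_smul, h, sub_self]
  rw [smul_eq_zero] at h1
  rcases h1 with h1 | h1
  · rw [sub_eq_zero.mp h1, one_mul]
  · exact absurd h1 (Φ.R v).frob_ne_zero

end RealifiedFamily

end Literature.AnabelianGeometry.AbsoluteAnabelian

end
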